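import Literature.NumberTheory.GaloisRepresentations.SerreWeight
import Literature.NumberTheory.GaloisRepresentations.SerreWeightShapeProofs
import Literature.NumberTheory.GaloisRepresentations.TameInertiaProofs
import Literature.NumberTheory.GaloisRepresentations.TameInertiaCyclicProofs
import Literature.NumberTheory.GaloisRepresentations.ModPGaloisRepProofs
import Literature.NumberTheory.GaloisRepresentations.HerbrandFunction
import Literature.NumberTheory.GaloisRepresentations.LocalGaloisGroupHenselProofs
import Literature.NumberTheory.GaloisRepresentations.RamificationFiltrationTowerProofs
import HarnessLib

/-!
# The last leaf of Serre's weight recipe: `I_F^v ↠ Gal(E/F)^v` (trunk GalRep, item C16, Serre §2.1)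

The existence statement `Literature.ModPGaloisRep.exists_isSerreWeight ρ ι` of `SerreWeight.lean`
(Serre, Duke Math. J. 54 (1987), §2.1, Prop. 1 with the normalisations of §2.2–2.4: one of the
three cases of the recipe applies) is assembled in `SerreWeightShapeProofs.lean`
(`ModPGaloisRep.InertiaShape.exists_isSerreWeight_of_facts`) from three structure facts on the
inertia group stated in `TameInertia.lean`:

* `absUpperInertia_map_isPGroup` — **proved** (`TameInertiaProofs.absUpperInertia_map_isPGroup_holds`:
  `G_1` of a finite Galois level is a `p`-group, Serre, *Local Fields*, IV §2 Cor. 3);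
* `absInertia_map_isCyclic` — a tamely ramified continuous `f : Γ_F → H` (`H` discrete) has
  `f(I_F)` cyclic of order prime to `p`; its finite-level input is **proved**
  (`TameInertiaCyclicProofs.isCyclic_map_inertia_of_forall_mem_ramificationSubgroup_one`: the
  image of `G_0` under a homomorphism killing `G_1` is cyclic of order prime to `p`, via Serre's
  `θ₀`, IV §2 Prop. 7 and Cor. 1), and what is missing is exactly the surjectivity
  `I_F^v ↠ Gal(E/F)^v` (Herbrand's theorem) to see that a tame `f` kills `G_1 = G^{φ(1)}`;
* `exists_eq_kummerCharacter_pow` — the characters of `I_F` (Serre 1972, §1.7 Prop. 5).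

This file states that missing surjectivity as the named fact
`absUpperInertia_map_absRestrictNormalHom F` (Serre, *Local Fields*, Ch. IV §3, Prop. 14 and
Remark 1), proves it in characteristic `0` from the tree's Herbrand leaf `herbrand_quotient`
(through `RamificationFiltrationTowerProofs.absUpperRamificationSubgroup_map_eq_of_herbrand_quotient`),
derives `absInertia_map_isCyclic` from it (`absInertia_map_isCyclic_of`), and restates the
existence of a Serre weight on the two remaining leaves:

* `Literature.ModPGaloisRep.exists_isSerreWeight_of hD ρ ι hA : ρ.exists_isSerreWeight ι`
  (`hD : absUpperInertia_map_absRestrictNormalHom F`, `hA : exists_eq_kummerCharacter_pow F k`);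
* `Literature.NumberTheory.GaloisRepresentations.ModPGaloisRep.exists_isSerreWeight_of_herbrand_quotient` — in characteristic `0`, from
  `herbrand_quotient` at the finite layers and `hA` alone.

## References

* [Serre1987] J.-P. Serre, *Sur les représentations modulaires de degré 2 de `Gal(ℚ̄/ℚ)`*, Duke
  Math. J. 54 (1987), §2.1 Prop. 1, §2.2–2.4.
* [SerreLocalFields1979] J.-P. Serre, *Local Fields*, GTM 67, Springer 1979, Ch. IV §2 Prop. 7,
  Cor. 1 and Cor. 3; §3 Prop. 14 and Remark 1.
-/

noncomputable section

open scoped Valued Pointwise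
open Field ValuativeRel

namespace Literature.NumberTheory.GaloisRepresentations

universe u v

namespace SerreWeightExistence

open GaloisRepresentations.IsNonarchimedeanLocalField

/-! ### Glue at a finite level -/

section Glue

variable {F : Type u} [Field F]

/-- The restriction `Γ_F → Gal(E/F)` to a normal intermediate field of `F̄/F` is surjective
(Mathlib `AlgEquiv.restrictNormalHom_surjective`, transported through
`Field.absoluteGaloisGroup.toAlgEquiv`). [folklore] -/
theorem absRestrictNormalHom_surjective (E : IntermediateField F (AlgebraicClosure F)) [Normal F E] :
    Function.Surjective (absRestrictNormalHom (K := F) E) := fun τ => by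
  obtain ⟨σ, hσ⟩ := AlgEquiv.restrictNormalHom_surjective (F := F) (K₁ := E)
    (E := AlgebraicClosure F) τ
  exact ⟨(absoluteGaloisGroup.toAlgEquiv F).symm σ, hσ⟩


variable [ValuativeRel F] [TopologicalSpace F] [IsNonarchimedeanLocalField F]

/-- Notation-free abbreviation: the prime `𝔓_E = 𝔓 ∩ E` of `integralClosure 𝒪[F] E` below
`𝔓 = absMaximalIdeal F`, for an intermediate field `E` of `F̄/F`. [folklore] -/
abbrev absMaximalIdealBelow (E : IntermediateField F (AlgebraicClosure F)) :
    Ideal (integralClosure 𝒪[F] E) :=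
  (absMaximalIdeal F).comap (E.integralClosureToAbsIntegers 𝒪[F])

open GaloisRepresentations.IsNonarchimedeanLocalField in
/-- The restriction of `I_F` to a finite normal `E/F` lies in the inertia group of `𝔓_E`
(equivariance of `integralClosure 𝒪[F] E → S`). Ref: Serre, *Local Fields*, Ch. I §7, Prop. 22. [folklore] -/
theorem absRestrictNormalHom_mem_inertia (E : IntermediateField F (AlgebraicClosure F)) [Normal F E]
    {σ : absoluteGaloisGroup F} (hσ : σ ∈ absInertia F) :
    absRestrictNormalHom E σ ∈ (absMaximalIdealBelow E).inertia (E ≃ₐ[F] E) := by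
  refine AddSubgroup.mem_inertia.mpr fun x => ?_
  change E.integralClosureToAbsIntegers 𝒪[F] (absRestrictNormalHom E σ • x - x) ∈ absMaximalIdeal F
  have heq : E.integralClosureToAbsIntegers 𝒪[F] (absRestrictNormalHom E σ • x) =
      σ • E.integralClosureToAbsIntegers 𝒪[F] x :=
    E.integralClosureToAbsIntegers_restrictNormalHom_smul 𝒪[F] σ x
  rw [map_sub, heq]
  exact hσ _


omit [ValuativeRel F] [TopologicalSpace F] [IsNonarchimedeanLocalField F] in
/-- **Finite image, at a finite Galois level.**  A continuous homomorphism `f : Γ_F → H` into a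
discrete group factors through the Galois group of a finite *Galois* subextension `E/F` of `F̄`
(`TameInertiaProofs.exists_isGalois_ker_le`: `ker f` is open and contains the fixing group of a
finite Galois `E`; quotient by `ker (Γ_F → Gal(E/F))`).
Ref: Serre, Duke Math. J. 54 (1987), §1.1 ("`ρ` est continue, donc d'image finie"). [folklore] -/
theorem exists_factorsThrough {H : Type*} [Group H] [TopologicalSpace H] [DiscreteTopology H]
    (f : absoluteGaloisGroup F →ₜ* H) :
    ∃ (E : IntermediateField F (AlgebraicClosure F)) (_ : FiniteDimensional F E) (_ : IsGalois F E)
      (f' : (E ≃ₐ[F] E) →* H), ∀ σ, f σ = f' (absRestrictNormalHom E σ) := by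
  obtain ⟨E, _, _, hkerle⟩ := exists_isGalois_ker_le F f
  have hsurj := absRestrictNormalHom_surjective (F := F) E
  let e := QuotientGroup.quotientKerEquivOfSurjective _ hsurj
  refine ⟨E, inferInstance, inferInstance,
    (QuotientGroup.lift _ f.toMonoidHom hkerle).comp e.symm.toMonoidHom, fun σ => ?_⟩
  have he : e.symm (absRestrictNormalHom E σ) = (σ : absoluteGaloisGroup F ⧸ (absRestrictNormalHom E).ker) := by
    rw [MulEquiv.symm_apply_eq]
    rfl
  rw [MonoidHom.comp_apply, MulEquiv.coe_toMonoidHom, he, QuotientGroup.lift_mk]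
  rfl

end Glue

section HerbrandGlue

variable {S : Type*} [CommRing S] (𝔓 : Ideal S) (G : Type*) [Group G] [MulSemiringAction G S]

/-- **`G^{φ(1)} = G_1`** (finite `G`). Ref: Serre, *Local Fields*, Ch. IV §3. [folklore] -/
theorem upperRamificationSubgroup_herbrandPhi_one [Finite G] :
    upperRamificationSubgroup 𝔓 G (herbrandPhi 𝔓 G 1) = 𝔓.ramificationSubgroup G 1 := by
  rw [upperRamificationSubgroup_herbrandPhi_holds 𝔓 G 1, Nat.ceil_one]

end HerbrandGlue

end SerreWeightExistence

/-! ### The named fact: `I_F^v` maps onto `Gal(E/F)^v` -/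

section Facts

variable (F : Type u) [Field F] [ValuativeRel F] [TopologicalSpace F] [IsNonarchimedeanLocalField F]

open GaloisRepresentations.IsNonarchimedeanLocalField

/-- **The absolute upper-numbering filtration maps onto each finite level.**  For a finite Galois
subextension `E/F` of `F̄` and every `v ≥ 0`, the restriction `Γ_F → Gal(E/F)` maps
`I_F^v = absUpperInertia F v` onto the finite-level group `Gal(E/F)^v` at `𝔓_E = 𝔓 ∩ E`
(`upperRamificationSubgroup`).  (Serre defines `G^v` of an infinite Galois extension as
`lim← G(L'/K)^v` over the finite Galois subextensions, Remark 1; the transition maps are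
surjective by Herbrand's theorem, Prop. 14, so the projections are surjective.  The inclusion
`⊆` holds by definition of `absUpperInertia`, cf. the generic
`absUpperRamificationSubgroup_map_absRestrictNormalHom_le`.)

**Relation to the tree's Herbrand stack.**  The printed result is already carried by the leaf
`Literature.NumberTheory.GaloisRepresentations.herbrand_quotient` (`RamificationFiltration.lean`, Prop. 14 at a finite Galois level) and
the *proved* passage to the limit `Literature.NumberTheory.GaloisRepresentations.absUpperRamificationSubgroup_map_eq_of_herbrand_quotient`
(`RamificationFiltrationTowerProofs.lean`, characteristic `0`); for a local field of
characteristic `0` the present fact therefore follows from `herbrand_quotient`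
(`absUpperInertia_map_absRestrictNormalHom_of_herbrand_quotient` below), and its number-field
twin is `absUpperRamificationSubgroup_map_absRestrictNormalHom` (`ArtinConductorIntegrality.lean`).
A separate leaf is needed only in characteristic `p`, where the infimum defining
`absUpperInertia` also runs over finite *normal inseparable* levels `E'`: these are implied by
their Galois subfields (`f(E'/E'_sep) = 1`, so `v_{E'}(σx - x) = v_{E'_sep}(σ x^{p^r} - x^{p^r})`,
`G_i(E') ⊇ G_i(E'_sep)`, `φ_{E'} ≥ φ_{E'_sep}`, `G^v(E') ⊇ G^v(E'_sep)`), a reduction that is not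
in Serre.  Stated for `v ≥ 0` only, where the tree's conventions for `φ`, `ψ` agree with Serre's.
[cite: SerreLocalFields1979, Ch. IV §3 Prop. 14 and Remark 1] -/
def absUpperInertia_map_absRestrictNormalHom : Prop :=
  ∀ (E : IntermediateField F (AlgebraicClosure F)) [FiniteDimensional F E] [IsGalois F E] (v : ℝ)
    (_hv : 0 ≤ v),
    (absUpperInertia F v).map (absRestrictNormalHom E) =
      upperRamificationSubgroup ((absMaximalIdeal F).comap (E.integralClosureToAbsIntegers 𝒪[F]))
        (E ≃ₐ[F] E) v

/-- **Characteristic `0`: fact D from the Herbrand leaf.**  For a local field of characteristic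
`0`, `absUpperInertia_map_absRestrictNormalHom F` follows from Herbrand's theorem at the finite
layers of `F̄` (the named fact `herbrand_quotient`, hypothesis `hq`) by the proved passage to the
limit `absUpperRamificationSubgroup_map_eq_of_herbrand_quotient` (`𝒪[F]` is Dedekind,
`𝔓 = absMaximalIdeal F` is maximal with finite `𝒪[F] ⧸ (𝔓 ∩ 𝒪[F]) = 𝓀[F]`).
[cite: SerreLocalFields1979, Ch. IV §3 Prop. 14 and Remark 1] -/
theorem absUpperInertia_map_absRestrictNormalHom_of_herbrand_quotient [CharZero F]
    (hq : ∀ {E E' : IntermediateField F (AlgebraicClosure F)} (hle : E ≤ E'),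
      herbrand_quotient 𝒪[F] (IntermediateField.restrict hle)) :
    absUpperInertia_map_absRestrictNormalHom F := by
  intro E _ _ v _
  haveI : (absMaximalIdeal F).IsMaximal := absMaximalIdeal_isMaximal_holds F
  haveI : Finite (𝒪[F] ⧸ (absMaximalIdeal F).under 𝒪[F]) := by
    rw [under_absMaximalIdeal_holds F]
    exact inferInstanceAs (Finite 𝓀[F])
  exact absUpperRamificationSubgroup_map_eq_of_herbrand_quotient 𝒪[F] hq (absMaximalIdeal F) E v

end Facts

namespace SerreWeightExistence

/-! ### `absInertia_map_isCyclic` from the surjectivity fact -/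

section Tame

variable {F : Type u} [Field F] [ValuativeRel F] [TopologicalSpace F] [IsNonarchimedeanLocalField F]
variable (H : Type*) [Group H] [TopologicalSpace H]

open GaloisRepresentations.IsNonarchimedeanLocalField

/-- **Discharge of `absInertia_map_isCyclic` from fact D.**  If a continuous homomorphism `f`
into a discrete group kills every `I_F^v`, `v > 0`, then `f(I_F)` is cyclic of order prime to `p`:
`f` factors through a finite Galois level `E` (`exists_factorsThrough`) by `f' : Gal(E/F) → H`,
which kills `G_1(E) = G^{φ(1)}(E)` because `I_F^{φ(1)}` maps onto `G^{φ(1)}(E)` (fact D); hence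
`f'(G_0(E))` is cyclic of order prime to `p`
(`isCyclic_map_inertia_of_forall_mem_ramificationSubgroup_one`, Serre's `θ₀`), and
`f(I_F) = f'(I_F|_E) ≤ f'(G_0(E))`.
[cite: SerreLocalFields1979, Ch. IV §2 Cor. 1 of Prop. 7] -/
theorem absInertia_map_isCyclic_of (hD : absUpperInertia_map_absRestrictNormalHom F) :
    absInertia_map_isCyclic F H := by
  intro _ f hf
  obtain ⟨E, _, _, f', hf'⟩ := exists_factorsThrough f
  -- `f'` kills `G_1(E) = G^{φ(1)}(E)`
  have hG1 : ∀ g ∈ (absMaximalIdealBelow E).ramificationSubgroup (E ≃ₐ[F] E) 1, f' g = 1 := by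
    intro g hg
    rw [← upperRamificationSubgroup_herbrandPhi_one (absMaximalIdealBelow E) (E ≃ₐ[F] E),
      ← hD E (herbrandPhi (absMaximalIdealBelow E) (E ≃ₐ[F] E) 1)
        (herbrandPhi_pos (absMaximalIdealBelow E) (E ≃ₐ[F] E) one_pos).le] at hg
    obtain ⟨σ, hσ, rfl⟩ := hg
    rw [← hf']
    exact hf _ (herbrandPhi_pos (absMaximalIdealBelow E) (E ≃ₐ[F] E) one_pos) σ hσ
  obtain ⟨hcyc, hcop⟩ := isCyclic_map_inertia_of_forall_mem_ramificationSubgroup_one F E f' hG1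
  -- `f(I_F) ≤ f'(G_0(E))`
  have hle : (absInertia F).map f.toMonoidHom ≤
      ((absMaximalIdealBelow E).inertia (E ≃ₐ[F] E)).map f' := by
    rintro _ ⟨σ, hσ, rfl⟩
    exact ⟨absRestrictNormalHom E σ, absRestrictNormalHom_mem_inertia E hσ, (hf' σ).symm⟩
  haveI := hcyc
  refine ⟨?_, ?_⟩
  · exact isCyclic_of_surjective _ (Subgroup.subgroupOfEquivOfLe hle).surjective
  · exact Nat.Coprime.coprime_dvd_left (Subgroup.card_dvd_of_le hle) hcop

end Tame

/-! ### The existence of a Serre weight on the remaining leaves -/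

section Main

variable {F : Type u} [Field F] [ValuativeRel F] [TopologicalSpace F] [IsNonarchimedeanLocalField F]
variable {k : Type v} [Field k] [TopologicalSpace k]

open GaloisRepresentations.IsNonarchimedeanLocalField

/-- **Existence of a Serre weight, on the remaining leaves.**  For every continuous
`ρ̄ : Γ_F → GL₂(k)` (`k` discrete) and residue embedding `ι`, one of the three cases of Serre's
recipe applies (`ModPGaloisRep.exists_isSerreWeight`), granted the surjectivity fact D of this file
and the structure of the characters of `I_F` (`exists_eq_kummerCharacter_pow`, `TameInertia.lean`):
the assembly is `InertiaShape.exists_isSerreWeight_of_facts` (`SerreWeightShapeProofs.lean`), fed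
with `absUpperInertia_map_isPGroup_holds` and `absInertia_map_isCyclic_of hD`.
Ref: Serre, Duke Math. J. 54 (1987), §2.1 Prop. 1, §2.2–2.4.
[cite: Serre1987, §2.1 Prop. 1; §2.2–2.4] -/
theorem _root_.Literature.NumberTheory.GaloisRepresentations.ModPGaloisRep.exists_isSerreWeight_of
    (hD : absUpperInertia_map_absRestrictNormalHom F) (ρ : ModPGaloisRep F k 2)
    (ι : absIntegers 𝒪[F] F ⧸ absMaximalIdeal F →+* k) (hA : exists_eq_kummerCharacter_pow F k) :
    ρ.exists_isSerreWeight ι :=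
  ModPGaloisRep.InertiaShape.exists_isSerreWeight_of_facts (absUpperInertia_map_isPGroup_holds F _)
    (absInertia_map_isCyclic_of _ hD) hA ρ ι

/-- **Characteristic `0`**: existence of a Serre weight from Herbrand's theorem at the finite
layers of `F̄` (the named fact `herbrand_quotient`, item C9) and the structure of the characters of
`I_F` (`exists_eq_kummerCharacter_pow`) alone. [cite: Serre1987, §2.1 Prop. 1; §2.2–2.4] -/
theorem _root_.Literature.NumberTheory.GaloisRepresentations.ModPGaloisRep.exists_isSerreWeight_of_herbrand_quotient [CharZero F]
    (hq : ∀ {E E' : IntermediateField F (AlgebraicClosure F)} (hle : E ≤ E'),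
      herbrand_quotient 𝒪[F] (IntermediateField.restrict hle))
    (ρ : ModPGaloisRep F k 2) (ι : absIntegers 𝒪[F] F ⧸ absMaximalIdeal F →+* k)
    (hA : exists_eq_kummerCharacter_pow F k) : ρ.exists_isSerreWeight ι :=
  ρ.exists_isSerreWeight_of (absUpperInertia_map_absRestrictNormalHom_of_herbrand_quotient F hq) ι hA

end Main

end SerreWeightExistence

end Literature.NumberTheory.GaloisRepresentations
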